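import Summits.Langlands.Langlands.Theorems.SoloInformedPinExclusion
import HarnessLib

/-!
# Pin exclusion at the level of the specification

Solo seat `solo-Langlands-informed`, session 58 (sequel to `SoloInformedPinExclusion`).

`SoloInformedPinExclusion` proved, for every family `D` of `p`-adic Hodge data meeting clause (F2)
(the cyclotomic character is `D`-de Rham), that direction (B) read with `D` and direction (A) read
with the twin `twistFamily D` are not both true, and deduced `¬ (Langlands ∧ LanglandsWith (twist ∘ pst))`
under `FontaineDatumExists`.  This file removes the reference to the particular pin: write
`IsSpecFamily D` for "every member `D ℓ v hv` satisfies Fontaine's specification `IsFontaineDatum`"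
— exactly the predicate the `ε`-term `fontainePst` is chosen over.  Then

* `isSpecFamily_twistFamily` — the twin of an admissible family is admissible
  (`PstSpecTwist.isFontaineDatum_twistOff`);
* `not_glcWith_and_glcWith_twist` — for EVERY admissible `D`, every number field `K` and all
  reciprocity data `𝓡`: `¬ (GLCWith 1 K D 𝓡 hcpt ∧ GLCWith 1 K (twistFamily D) 𝓡 hcpt)`;
* `not_langlandsWith_and_langlandsWith_twist` — for every admissible choice of data over every number
  field: `¬ (LanglandsWith D ∧ LanglandsWith (twist ∘ D))`; equivalently
  `langlandsWith_imp_not_langlandsWith_twist`;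
* `spec_underdetermines_langlands` — every admissible choice `D` has an admissible twin `D'` with
  `¬ (LanglandsWith D ∧ LanglandsWith D')`;
* the case `D = pst` (the summit as typed, `langlandsWith_pstFamily_iff`) is
  `not_langlands_and_langlandsWith_twist` of the parent file
  (= `not_langlandsWith_and_langlandsWith_twist _ (isSpecFamily_pstFamily hE)`), under
  `FontaineDatumExists`, which is what makes the pin admissible.
* `forall_langlandsWith_imp_not_isSpecFamily`, `not_forall_langlandsWith` (session 61) — the
  "outer `∀`" reading `∀ D admissible, LanglandsWith D` implies that NO admissible family exists, so
  under `FontaineDatumExists` it is false: quantifying universally over the specification is not a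
  repair of the statement.

Reading.  The clauses of `IsFontaineDatum` alone under-determine the truth value of the summit: no
choice of witness for the `ε`-term — the tree's or any other — makes `Langlands` derivable from the
specification, because each admissible reading has an admissible twin excluding it.  What decides
between twins is the CONSTRUCTION `WD ∘ D_pst` (definition item D2), absent from the tree; the
statement-repair R3⁺ (`SoloInformedRepairR3plus`) avoids the `ε`-term altogether.  No new axioms.
-/

open scoped MatrixGroups Matrix NumberField Classical
open NumberField IsDedekindDomain Field Filter ValuativeRel
open Literature.NumberTheory.Automorphic Literature.NumberTheory.GaloisRepresentations
  Literature.NumberTheory.PAdicHodge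

noncomputable section

namespace Summit.Langlands.Langlands.Theorems
namespace PinExclusion

variable {K : Type} [Field K] [NumberField K]

/-- **Fontaine's specification for a family of data**: every member `D ℓ v hv` satisfies
`IsFontaineDatum` (the predicate the `ε`-term `fontainePst` is chosen over). [folklore] -/
def IsSpecFamily (D : DatumFamily K) : Prop :=
  ∀ (ℓ : ℕ) [Fact ℓ.Prime] (v : HeightOneSpectrum (𝓞 K)) (hv : ((ℓ : ℕ) : 𝓞 K) ∈ v.asIdeal),
    haveI := LocalField.charZero_adicCompletion v
    IsFontaineDatum (LocalField.valuation_adicCompletion_natCast_lt_one v ℓ hv) (D ℓ v hv)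

/-- The twin of an admissible family is admissible (`PstSpecTwist.isFontaineDatum_twistOff`: all
clauses of the specification are preserved by the twist). [folklore] -/
theorem isSpecFamily_twistFamily {D : DatumFamily K} (hD : IsSpecFamily D) :
    IsSpecFamily (twistFamily D) := fun ℓ _ v hv => by
  haveI := LocalField.charZero_adicCompletion v
  exact PstSpecTwist.isFontaineDatum_twistOff (hD ℓ v hv) _

/-- The pinned family is admissible (under Fontaine's existence theorem). [folklore] -/
theorem isSpecFamily_pstFamily (hE : FontaineDatumExists) : IsSpecFamily (pstFamily K) :=
  fun ℓ _ v hv => isFontaineDatum_fontainePstAdicCompletion hE v ℓ hv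

/-- An admissible family meets clause (F2): the cyclotomic character is de Rham for every member.
[folklore] -/
theorem IsSpecFamily.isDeRhamFramed_cyclotomic {D : DatumFamily K} (hD : IsSpecFamily D) (ℓ : ℕ)
    [Fact ℓ.Prime] (v : HeightOneSpectrum (𝓞 K)) (hv : ((ℓ : ℕ) : 𝓞 K) ∈ v.asIdeal) :
    (D ℓ v hv).IsDeRhamFramed (FramedGaloisRep.cyclotomicPadicAlgCl (v.adicCompletion K) ℓ) := by
  haveI := LocalField.charZero_adicCompletion v
  exact (hD ℓ v hv).cyclotomicWeightNegOne.isDeRhamFramed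

/-- **The specification does not decide the summit for `GL₁`**: for every admissible family `D`
(every `K`, all `𝓡`), the summit read with `D` and the summit read with its admissible twin are not
both true. [folklore] -/
theorem not_glcWith_and_glcWith_twist {D : DatumFamily K} (hD : IsSpecFamily D)
    (𝓡 : ReciprocityData K) (hcpt : isCompact_glFiniteIntegralLevel 1 K) :
    ¬ (GLCWith 1 K D 𝓡 hcpt ∧ GLCWith 1 K (twistFamily D) 𝓡 hcpt) := by
  rintro ⟨h₁, h₂⟩
  obtain ⟨v₀, hv₀⟩ := exists_natCast_mem_asIdeal K 2
  exact not_galoisToAutomorphicWith_and_automorphicToGaloisWith_twist 𝓡 hcpt D 2 v₀ hv₀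
    (hD.isDeRhamFramed_cyclotomic 2) ⟨h₁.2, h₂.1⟩

/-- **The specification does not decide `Langlands`**: for every admissible choice of data over every
number field, `LanglandsWith D` and `LanglandsWith (twist ∘ D)` are not both true. [folklore] -/
theorem not_langlandsWith_and_langlandsWith_twist
    (D : ∀ (K : Type) [Field K] [NumberField K], DatumFamily K)
    (hD : ∀ (K : Type) [Field K] [NumberField K], IsSpecFamily (D K)) :
    ¬ (LanglandsWith D ∧ LanglandsWith (fun K _ _ => twistFamily (D K))) := by
  rintro ⟨h₁, h₂⟩
  obtain ⟨⟨𝓡⟩, h₁'⟩ := h₁ ℚ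
  obtain ⟨-, h₂'⟩ := h₂ ℚ
  have hcpt : isCompact_glFiniteIntegralLevel 1 ℚ := isCompact_glFiniteIntegralLevel_holds 1 ℚ
  exact not_glcWith_and_glcWith_twist (hD ℚ) 𝓡 hcpt
    ⟨h₁' 𝓡 1 Nat.one_pos hcpt, h₂' 𝓡 1 Nat.one_pos hcpt⟩

/-- … equivalently: an admissible reading of the summit that holds refutes its admissible twin.
[folklore] -/
theorem langlandsWith_imp_not_langlandsWith_twist
    (D : ∀ (K : Type) [Field K] [NumberField K], DatumFamily K)
    (hD : ∀ (K : Type) [Field K] [NumberField K], IsSpecFamily (D K)) (h : LanglandsWith D) :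
    ¬ LanglandsWith (fun K _ _ => twistFamily (D K)) :=
  fun h' => not_langlandsWith_and_langlandsWith_twist D hD ⟨h, h'⟩

/-- **Every admissible choice of data has an admissible twin excluding it.** [folklore] -/
theorem spec_underdetermines_langlands
    (D : ∀ (K : Type) [Field K] [NumberField K], DatumFamily K)
    (hD : ∀ (K : Type) [Field K] [NumberField K], IsSpecFamily (D K)) :
    ∃ D' : ∀ (K : Type) [Field K] [NumberField K], DatumFamily K,
      (∀ (K : Type) [Field K] [NumberField K], IsSpecFamily (D' K)) ∧
        ¬ (LanglandsWith D ∧ LanglandsWith D') :=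
  ⟨fun K _ _ => twistFamily (D K), fun K _ _ => isSpecFamily_twistFamily (hD K),
    not_langlandsWith_and_langlandsWith_twist D hD⟩

/-- **The "outer `∀`" reading of the summit holds only if Fontaine's specification is unsatisfiable**
(session 61): if `LanglandsWith D` held for EVERY admissible choice of data `D`, then no admissible
family would exist over any number field — apply the hypothesis to an admissible `D` and to its
admissible twin (`isSpecFamily_twistFamily`) and use `not_langlandsWith_and_langlandsWith_twist`.
So replacing the `ε`-pin by a universal quantifier over the specification is not a repair of the
summit statement (D2_SPEC §4, option "R4 outer"). [folklore] -/
theorem forall_langlandsWith_imp_not_isSpecFamily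
    (h : ∀ D : ∀ (K : Type) [Field K] [NumberField K], DatumFamily K,
      (∀ (K : Type) [Field K] [NumberField K], IsSpecFamily (D K)) → LanglandsWith D)
    (D : ∀ (K : Type) [Field K] [NumberField K], DatumFamily K) :
    ¬ ∀ (K : Type) [Field K] [NumberField K], IsSpecFamily (D K) := fun hD =>
  not_langlandsWith_and_langlandsWith_twist D hD
    ⟨h D hD, h _ fun K _ _ => isSpecFamily_twistFamily (hD K)⟩

/-- In particular, under Fontaine's existence theorem (which makes the pinned family admissible,
`isSpecFamily_pstFamily`) the "outer `∀`" reading of the summit is FALSE outright. [folklore] -/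
theorem not_forall_langlandsWith (hE : FontaineDatumExists) :
    ¬ ∀ D : ∀ (K : Type) [Field K] [NumberField K], DatumFamily K,
      (∀ (K : Type) [Field K] [NumberField K], IsSpecFamily (D K)) → LanglandsWith D := fun h =>
  forall_langlandsWith_imp_not_isSpecFamily h (fun K _ _ => pstFamily K)
    fun _ _ _ => isSpecFamily_pstFamily hE

end PinExclusion
end Summit.Langlands.Langlands.Theorems

end
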